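import Literature.Probability.FitznerVanDerHofstad2017.Stage1StateD10Rev3
import Summits.CriticalPhenomena.LaceExpansionHighD.MeanFieldD10CertRev2
import HarnessLib

/-!
# `d = 10`, tuple of record: the KERNEL TIE of the Level-C stage-1 state `CertD10.stateRev3` to the certificate's constants
# `GammaRev2 / cMuRev2 / cWeightsRev2` and to the family `nobleTripleSnoc 10 (1, 17, {0})` (the `d = 10` analogue of W48.1)

pub-lace10 cell, ENGINE seat (unit `pub-lace10-eng-g9`), Level-C groundwork item «P40 STATE RECORD — kernel tie» (cell inventory
ESTIMATE-INVENTORY.md §2 A5: «the KERNEL TIE of the new P40 state record to the certificate's constants (GammaRev2/3, cMuRev2, cWeightsRev2, the family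
`nobleTripleSnoc 10 (1, 17, {0})`), including the ORDER of the six c-weights — d = 11 needed an explicit permutation lemma `stateRec_c_finRotate`»;
lead work breakdown LEVELC-TASKS P0.4).  ADDITIVE module: nothing of record is touched (`MeanFieldD10CertRev2` p321303 and the Literature state module
`Stage1StateD10Rev3` are imported unchanged); NO `def`, no named fact, no hypothesis; every statement is a literal identity decided by `norm_num`.

WHAT IS PROVED (kernel arithmetic, `ℚ → ℝ` casts of the rational state record against the certificate's real literals):
* `GammaRev3Q_cast`, `cmuRev3_cast`, `cWeightsRev3Q_cast` — the rational copies ARE the certificate's `Γ` (3 entries), `c_μ`, `c` (7 entries);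
  `Gamma3_eq_one : GammaRev2 2 = 1` (the state carries no `Γ₃` coordinate: cells 13–14 read `c_j·Γ₃ = c_j`);
* `stateRev3_Gamma1 : ((stateRev3.Gamma1 : ℚ) : ℝ) = GammaRev2 0` (`1.0155`), `stateRev3_Gamma2 : … = GammaRev2 1` (`1.16687669…`),
  `stateRev3_m_eq : ((stateRev3.m : ℚ) : ℝ) = GammaRev2 0 / ((2·10 − 1)·cMuRev2)` (`m = Γ₁/((2d−1)c_μ)`, [NoBLE17] App. D Step 1);
* the SLOT DICTIONARY `σ = (5, 0, 1, 2, 3, 4)`: `stateRev3_c j : ((stateRev3.c j : ℚ) : ℝ) = cWeightsRev2 (σ j).castSucc`, equivalently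
  `stateRev3_c_finRotate k : ((stateRev3.c (finRotate 6 k) : ℚ) : ℝ) = cWeightsRev2 k.castSucc` — the stage-1 device lists `(1,6,{0})` FIRST
  (`Stage1Frame.Data.initCell`), the certificate's `cWeightsRev2 : Fin 7 → ℝ` follows `nobleTripleSnoc 10 (1,17,{0}) = (nobleTriple 10, (1,17,{0}))`,
  which lists `(1,6,{0})` SIXTH and the weighted-bubble tail coordinate `(1,17,{0})` SEVENTH;
* `stateRev3_family k`: the weight in state slot `finRotate 6 k` is the certificate weight of the family member `nobleTripleSnoc 10 (1,17,{0}) k.castSucc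
  = nobleTriple 10 k`; `seventh_member`: the seventh member is `(1,17,{0})`, its weight `cWeightsRev2 6 > 0` has NO state slot (it is consumed by the
  `f₃` assembly only — Level B `MeanFieldD10F3CellsRev2.rowE16` / `cellE16`);
* `stateRev3_cast_eq`: the same four identities for the real state `stateRev3.cast : NoGoFrame.State` the device is run at.
So the `Γ_j`, `c_μ`, `c` of the bootstrap hypothesis `NobleImprovementInputsOf (nobleTripleSnoc 10 (1,17,{0})) cMuRev2 cWeightsRev2 GammaRev2 …` of
`meanField_d10_Rev2` (and of any re-cut at the same tuple, RULINGS D17 (2) / D21: `Rev3 := (δ)` at the UNCHANGED tuple) and the `(Γ₁, m, Γ₂, c)` a Level-C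
stage-1 instance at `CertD10.P40` feeds to the typed recipe are the SAME numbers, by the kernel and not by inspection.  This is the day-1 check the
inventory's A5 asks for; it is T-2-ruling-invariant (A6).

HONEST FRAMING.  Bookkeeping identities between literals already in the tree; no evaluation of any cell, no domination, no record, no new number, no
claim about percolation or about any dimension.  The record `MeanFieldD10CertRev2` stays CONDITIONAL on its binders exactly as before.
-/

namespace Summit.CriticalPhenomena.LaceExpansionHighD

namespace D10

open Literature.Barriers.CriticalPhenomena Literature.Probability.LatticeModels Literature.Probability.FitznerVanDerHofstad2017
open Stage1Cells

/-! ## §1  The rational copies are the certificate's literals -/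

/-- `GammaRev3Q` casts to `GammaRev2`, entry by entry (`Γ₁ = 1.0155`, `Γ₂ = 1.16687669…`, `Γ₃ = 1`). [cite: FitznerVanDerHofstad2017, §2.5 (choice of γ_i, Γ_i by iteration)] -/
theorem GammaRev3Q_cast (i : Fin 3) : ((CertD10.GammaRev3Q i : ℚ) : ℝ) = GammaRev2 i := by
  fin_cases i <;> simp [CertD10.GammaRev3Q, GammaRev2] <;> norm_num

/-- `cmuRev3` casts to `cMuRev2` (`c_μ = 1.003578400409219340067442046190689`). [cite: FitznerVanDerHofstad2017, (2.19) and §2.5] -/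
theorem cmuRev3_cast : ((CertD10.cmuRev3 : ℚ) : ℝ) = cMuRev2 := by
  norm_num [CertD10.cmuRev3, cMuRev2]

/-- `cWeightsRev3Q` casts to `cWeightsRev2`, all seven family weights. [cite: FitznerVanDerHofstad2017, (2.21)–(2.23) and Figure 3] -/
theorem cWeightsRev3Q_cast (k : Fin 7) : ((CertD10.cWeightsRev3Q k : ℚ) : ℝ) = cWeightsRev2 k := by
  fin_cases k <;> simp [CertD10.cWeightsRev3Q, cWeightsRev2] <;> norm_num

/-- `Γ₃ = 1` on the record line (the `f₃` ceiling is normalised to `1`; the stage-1 state carries no `Γ₃` coordinate — cells 13–14 read `c_j·Γ₃ = c_j`).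
[cite: FitznerVanDerHofstad2017, §2.5 (choice of γ_i, Γ_i by iteration) and (2.21)] -/
theorem Gamma3_eq_one : GammaRev2 2 = 1 ∧ CertD10.GammaRev3Q 2 = 1 :=
  ⟨by rw [← GammaRev3Q_cast 2, CertD10.stateRev3_Gamma.2.2]; norm_num, CertD10.stateRev3_Gamma.2.2⟩

/-! ## §2  The state's `Γ₁`, `Γ₂`, `m` are the certificate's -/

/-- `Γ₁` of the Level-C stage-1 state is the certificate's `Γ₁ = GammaRev2 0 = 1.0155`. [cite: FitznerVanDerHofstad2017, §2.5 (choice of γ_i, Γ_i by iteration)] -/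
theorem stateRev3_Gamma1 : ((CertD10.stateRev3.Gamma1 : ℚ) : ℝ) = GammaRev2 0 := by
  norm_num [CertD10.stateRev3, GammaRev2]

/-- `Γ₂` of the Level-C stage-1 state is the certificate's `Γ₂ = GammaRev2 1 = 1.166876692803335371520383185088449`. [cite: FitznerVanDerHofstad2017, §2.5 (choice of γ_i, Γ_i by iteration)] -/
theorem stateRev3_Gamma2 : ((CertD10.stateRev3.Gamma2 : ℚ) : ℝ) = GammaRev2 1 := by
  simp only [CertD10.stateRev3, GammaRev2, Matrix.cons_val_one, Matrix.cons_val_zero]; push_cast; norm_num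

/-- `m` of the Level-C stage-1 state is `Γ₁/((2d−1)c_μ)` with the certificate's `Γ₁ = GammaRev2 0`, `c_μ = cMuRev2`, `d = 10` (App. D Step 1: the bound
used for `μ_p` under `f₁(p) ≤ Γ₁`). [cite: FitznerVanDerHofstad2016NoBLE, App. D Step 1 p. 1110] -/
theorem stateRev3_m_eq : ((CertD10.stateRev3.m : ℚ) : ℝ) = GammaRev2 0 / ((2 * 10 - 1) * cMuRev2) := by
  norm_num [CertD10.stateRev3, GammaRev2, cMuRev2]

/-! ## §3  The slot dictionary of the six `f₃`-weights (the `d = 10` `stateRec_c_finRotate`) -/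

/-- state slot `0` = `(1,6,{0})` = family slot `5`. [cite: FitznerVanDerHofstad2017, (2.23) and §2.5] -/
theorem stateRev3_c0 : ((CertD10.stateRev3.c 0 : ℚ) : ℝ) = cWeightsRev2 5 := by
  simp only [CertD10.stateRev3, cWeightsRev2, Matrix.cons_val]; norm_num

/-- state slot `1` = `(0,0,𝒳)` = family slot `0`. [cite: FitznerVanDerHofstad2017, (2.23) and §2.5] -/
theorem stateRev3_c1 : ((CertD10.stateRev3.c 1 : ℚ) : ℝ) = cWeightsRev2 0 := by
  simp only [CertD10.stateRev3, cWeightsRev2, Matrix.cons_val]; norm_num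

/-- state slot `2` = `(1,0,𝒳)` = family slot `1`. [cite: FitznerVanDerHofstad2017, (2.23) and §2.5] -/
theorem stateRev3_c2 : ((CertD10.stateRev3.c 2 : ℚ) : ℝ) = cWeightsRev2 1 := by
  simp only [CertD10.stateRev3, cWeightsRev2, Matrix.cons_val]; norm_num

/-- state slot `3` = `(1,1,𝒳)` = family slot `2`. [cite: FitznerVanDerHofstad2017, (2.23) and §2.5] -/
theorem stateRev3_c3 : ((CertD10.stateRev3.c 3 : ℚ) : ℝ) = cWeightsRev2 2 := by
  simp only [CertD10.stateRev3, cWeightsRev2, Matrix.cons_val]; norm_num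

/-- state slot `4` = `(1,2,𝒳)` = family slot `3`. [cite: FitznerVanDerHofstad2017, (2.23) and §2.5] -/
theorem stateRev3_c4 : ((CertD10.stateRev3.c 4 : ℚ) : ℝ) = cWeightsRev2 3 := by
  simp only [CertD10.stateRev3, cWeightsRev2, Matrix.cons_val]; norm_num

/-- state slot `5` = `(1,3,𝒳)` = family slot `4`. [cite: FitznerVanDerHofstad2017, (2.23) and §2.5] -/
theorem stateRev3_c5 : ((CertD10.stateRev3.c 5 : ℚ) : ℝ) = cWeightsRev2 4 := by
  simp only [CertD10.stateRev3, cWeightsRev2, Matrix.cons_val]; norm_num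

/-- The `f₃`-weights of the Level-C stage-1 state are the certificate's `cWeightsRev2`, up to the index dictionary `σ = (5,0,1,2,3,4)` (then `castSucc`
into `Fin 7`): the state lists `(1,6,{0})` first, `nobleTripleSnoc 10 (1,17,{0})` lists it sixth. [cite: FitznerVanDerHofstad2017, (2.23) and §2.5] -/
theorem stateRev3_c (j : Fin 6) :
    ((CertD10.stateRev3.c j : ℚ) : ℝ) = cWeightsRev2 (((![5, 0, 1, 2, 3, 4] : Fin 6 → Fin 6) j).castSucc) := by
  fin_cases j
  exacts [stateRev3_c0, stateRev3_c1, stateRev3_c2, stateRev3_c3, stateRev3_c4, stateRev3_c5]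

/-- The same dictionary as a rotation: `stateRev3.c (finRotate 6 k) = cWeightsRev2 k.castSucc` (`finRotate 6 k = k + 1 (mod 6)`) — the `d = 10` twin of
`Stage1Cells.CertD11Rec.stateRec_c_finRotate`. [cite: FitznerVanDerHofstad2017, (2.23) and §2.5] -/
theorem stateRev3_c_finRotate (k : Fin 6) : ((CertD10.stateRev3.c (finRotate 6 k) : ℚ) : ℝ) = cWeightsRev2 k.castSucc := by
  fin_cases k
  exacts [stateRev3_c1, stateRev3_c2, stateRev3_c3, stateRev3_c4, stateRev3_c5, stateRev3_c0]

/-- The dictionary AT THE FAMILY of the record line: the weight in state slot `finRotate 6 k` is the certificate weight of the member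
`nobleTripleSnoc 10 (1,17,{0}) k.castSucc`, and that member is the record triple `nobleTriple 10 k` of [FvdH17] (2.23).
[cite: FitznerVanDerHofstad2017, (2.23) and §2.5] [cite: FitznerVanDerHofstad2016NoBLE, (2.7) (general finite 𝒮)] -/
theorem stateRev3_family (k : Fin 6) :
    ((CertD10.stateRev3.c (finRotate 6 k) : ℚ) : ℝ) = cWeightsRev2 k.castSucc ∧
      nobleTripleSnoc 10 ((1 : ℕ), (17 : ℕ), ({0} : Set (Site 10))) k.castSucc = nobleTriple 10 k :=
  ⟨stateRev3_c_finRotate k, nobleTripleSnoc_castSucc _ k⟩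

/-- The seventh family member is the weighted-bubble tail coordinate `(1,17,{0})`; its weight `c₇ = cWeightsRev2 6 = 0.00494852…` is positive and has NO
stage-1 state slot (the state has six; `c₇` enters the `f₃` assembly only). [cite: FitznerVanDerHofstad2016NoBLE, (2.7) (general finite 𝒮) and §5.3.1 (5.36)–(5.38)] -/
theorem seventh_member :
    nobleTripleSnoc 10 ((1 : ℕ), (17 : ℕ), ({0} : Set (Site 10))) (Fin.last 6) = ((1 : ℕ), (17 : ℕ), ({0} : Set (Site 10))) ∧
      0 < cWeightsRev2 6 ∧ ((CertD10.cWeightsRev3Q 6 : ℚ) : ℝ) = cWeightsRev2 6 :=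
  ⟨nobleTripleSnoc_last _, side_c7_pos_d10_Rev2, cWeightsRev3Q_cast 6⟩

/-! ## §4  The same identities for the real state the device is run at -/

/-- The real stage-1 state `stateRev3.cast : NoGoFrame.State` has `Γ₁ = GammaRev2 0`, `m = GammaRev2 0 / (19·cMuRev2)`, `Γ₂ = GammaRev2 1` and
`c (finRotate 6 k) = cWeightsRev2 k.castSucc`. [cite: FitznerVanDerHofstad2017, notebook Percolation.nb cells 1, 44, 48 (transcript l.94–99, 1214, 1320–1325)] -/
theorem stateRev3_cast_eq :
    CertD10.stateRev3.cast.Gamma1 = GammaRev2 0 ∧ CertD10.stateRev3.cast.m = GammaRev2 0 / ((2 * 10 - 1) * cMuRev2) ∧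
      CertD10.stateRev3.cast.Gamma2 = GammaRev2 1 ∧ ∀ k : Fin 6, CertD10.stateRev3.cast.c (finRotate 6 k) = cWeightsRev2 k.castSucc := by
  refine ⟨?_, ?_, ?_, fun k => ?_⟩
  · rw [StateQ.cast_Gamma1]; exact stateRev3_Gamma1
  · rw [StateQ.cast_m]; exact stateRev3_m_eq
  · rw [StateQ.cast_Gamma2]; exact stateRev3_Gamma2
  · rw [StateQ.cast_c]; exact stateRev3_c_finRotate k

/-- The WBX(16) o-cell envelope side condition of the record line, restated at the Level-C state: `stateRev3.cast.Gamma1 ≤ 2031/2000`,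
`stateRev3.cast.Gamma2 ≤ 119/100` (from `side_wbxEnvelopeO_d10_Rev2` through the tie). [cite: FitznerVanDerHofstad2016NoBLE, §5.3.1 (5.36)–(5.38) (envelope of the explicit-term cell)] -/
theorem stateRev3_cast_wbxEnvelopeO : CertD10.stateRev3.cast.Gamma1 ≤ 2031 / 2000 ∧ CertD10.stateRev3.cast.Gamma2 ≤ 119 / 100 := by
  obtain ⟨h1, -, h2, -⟩ := stateRev3_cast_eq
  rw [h1, h2]
  exact side_wbxEnvelopeO_d10_Rev2

end D10

end Summit.CriticalPhenomena.LaceExpansionHighD
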